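import Summits.QuantumFields.BalabanUV.Beta.FP.OneShotEffectiveForm
import Summits.QuantumFields.BalabanUV.Beta.GAN24.MultiplierDictionary
import Summits.QuantumFields.BalabanUV.Beta.GAN24.EffectiveLaplacianLimit

/-!
# `BalabanUV.Beta.FP.OneShotEffectiveFormLetters` — road «FP» for binder row D1, row **GAMMA-1** (torus instance), companion of
# `FP/OneShotEffectiveForm` (gan24-p3-g20, owner GO l.24514 (D)): **THE LETTERS OF THE TORUS CORNER** — (§1) the corner IS the periodisation of
# gan24-p2's infinite-volume (1.66) kernel `deltaZ` and converges to it exponentially in the torus size (RISK R-γ-9 for the leg `𝔊`, quantified);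
# (§2) X1 AT FINITE VOLUME WITH RATE: the normalised level-`k` corner tends to the periodised PERFECT effective Laplacian `Δ_∞ = deltaZLim` at the
# geometric rate `(L⁻²)^k`, uniformly in the torus; (§3) the minimiser leg `𝓘 = minOp` IS the momentum-space (1.63) operator `HkOp` and is
# exponentially localised uniformly in the level and the torus ([folklore] assembly of TREE theorems BY NAME; «not in print; our proof» for §1–§2)

HONEST DEPENDENCY (page 1, mandatory): continuum YM on T⁴ ⇐ BetaPertH ∧ nine spine estimates (0/9 proved); BetaPertH ⇐ (D1) ∧ (D4) ∧
CAP+tail; G-an2-4 gates asym, D1 and NE2/3/4.  HONEST FRAMING (cell contract, verbatim): «discharging `BetaPertH` makes Bałaban's UV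
stability UNCONDITIONAL — a real constructive-QFT result; it is NOT the continuum limit and NOT the Clay problem.»  THIS MODULE proves NO NEW estimate: every
bound below is a certified TREE estimate (gan24-p2's `DirichletExhaustionDeperiodise`∕`DirichletExhaustionDeltaZ`, this lineage's `GAN24.EffectiveLaplacianLimit`,
pv15's `B5Hk163Torus`) read through `OneShotEffectiveForm.effForm_eq_smul_DelK` ∕ `minOp_eq_Hk`; it defines nothing, cites nothing as a hypothesis, instantiates NO
wall binder; 0 sorry.  NEVER «G-an2-4 closed»; NOT (CONV-C) for `G_k∕H_k`, NOT hbook, NOT D1, NOT BetaPertH, NOT continuum, NOT Clay.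

ABSOLUTE RULE (cell charter, verbatim): «No internally-minted statement may enter as a cited fact. Every hypothesis is either kernel-proved in this
package or a verbatim quotation of a PUBLISHED theorem with page reference. The manuscript(s) under audit are NOT citable for their own disputed
steps — they are the thing under adjudication; programme-internal (2001/route/tribunal) claims are never citable.»

CONTENT (`n = L^k`; every `d`, every `L ≥ 1`, every `k`, every torus `M`; constants `c166Z d`, `kappaZ d`, `theta166Z d`, `latticeConst (d+1) (kappaZ d)`,
`MG163 (d+1)`, `periodConst (kappa163 (d+1)) d` of the tree — dimension-only):
* §1 `translate_eq_add_pshift`; **`effForm_re_eq_tsum_deltaZ`** — `Re 𝔊_M((z mod M, κ),(0, l)) = n^{d+1}·Σ_m deltaZ L k (z + M∘m, κ) (0, l)` (`OneShotEffectiveForm` §6 +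
  `MultiplierDictionary.wΦ_eq_deltaZ`); **`abs_effForm_re_sub_deltaZ_le`** — on tori with all sides `≥ N ≥ 1`,
  `|Re 𝔊_M − n^{d+1}·deltaZ L k (z,κ) (0,l)| ≤ n^{d+1}·c166Z·K_{d+1}(κ_Z)·e^{κ_Z·dist(0,z)}·e^{−κ_Z(N−1)}` (`DirichletExhaustionDeperiodise.abs_tsum_translate_sub_le`).
* §2 **`abs_effForm_re_sub_tsum_deltaZLim_le`** — `|n^{−(d+1)}·Re 𝔊_{M,k} − Σ_m Δ_∞(z + M∘m, …)| ≤ θ_Z·(L⁻²)^k·K_{d+1}(κ_Z)·e^{κ_Z·dist(0,z)}` on EVERY torus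
  (`EffectiveLaplacianLimit.deltaZ_sub_deltaZLim_abs_le` under the periodisation sum).
* §3 **`minOp_eq_HkOp`** (`minOp (Kop n M) (QvOp n M) = B5Hk163Torus.HkOp n M`, via `B5Hk163Form166.HkOp_eq_Hk`) and **`norm_minOp_bpt_le`** —
  `‖𝓘((n·x̄′ + a, μ), (x̄, λ))‖ ≤ MG163(d+1)·periodConst(κ₁₆₃(d+1), d)·e^{−(κ₁₆₃(d+1)∕(d+1))·|x′ − x|_{T,∞}}` (`B5Hk163Torus.norm_HkOp_le`), dimension `d + 1`.
  WHICH LETTERS OF RHOA-6c′ THIS INSTANTIATES (owner's ask l.25038; `FP/MixLoopPowerCountingMass`, R-FP-26 (b)): it is the SHAPE of the field-leg interpolation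
  letter **(I)** `|I c u| ≤ C_I·e^{−(δ∕n)‖c − n•u‖∞}` and of the reference-leg letter **(J)** `|J b v₀| ≤ C_J·e^{−(δ∕n)‖b − n•v₀‖∞}` for the leg `𝓘 = minOp` AT `U = 𝟙`
  ON THE TORUS, written in block-index currency (fine point `c = n·x̄′ + a`, coarse row `u = x̄`; `‖c − n•u‖∞ ≤ n·(|x′ − x|_{T,∞} + 1)`, so `δ := κ₁₆₃(d+1)∕(d+1)` up to the
  factor `e^{δ}` in `C_I`); the running-leg coarse-moment letter **(J′)** is the lattice sum of (J) with the weight `1 + ‖b′ − n•v‖²∕n²` — a consequence by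
  `periodConst`-type summation, NOT restated here; (U)(W)(M) concern the averaging jets, not this leg.
Provenance: unit b2b-balaban-gan24-p3 gen 20 (prover-b2b-balaban-gan24-p3-g20-0), 2026-08-21, row GAMMA-1 (torus instance, letters).
-/

noncomputable section

open scoped BigOperators Matrix ComplexConjugate ComplexOrder

namespace Summit.QuantumFields.BalabanUV.Beta.FP.OneShotEffectiveFormLetters

open Literature.MathematicalPhysics.QuantumFieldTheory.Balaban1983to89.B5Prop11Plancherel (Tor fine)
open Literature.MathematicalPhysics.QuantumFieldTheory.Balaban1983to89.B5Block118 (QvOp)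
open Literature.MathematicalPhysics.QuantumFieldTheory.Balaban1983to89.Beta.BlockEffectiveAction (Kop)
open Literature.MathematicalPhysics.QuantumFieldTheory.Balaban1983to89.Beta.CompositionSingular (effForm minOp)
open Literature.MathematicalPhysics.QuantumFieldTheory.Balaban1983to89.Beta.KernelSpecInstance (wΦ)
open Literature.MathematicalPhysics.QuantumFieldTheory.Balaban1983to89.Beta.AffineAveraging (Site)
open Literature.MathematicalPhysics.QuantumFieldTheory.Balaban1983to89.B6Cov2156Torus (one_le_M)
open Summit.QuantumFields.BalabanUV.Beta.GAN24.TorusAvatar (toTor)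
open Summit.QuantumFields.BalabanUV.Beta.GAN24.TorusPeriodise (pshift)
open Summit.QuantumFields.BalabanUV.Beta.GAN24.MonotoneTorusEffective (one_le_pow_Lc)
open Summit.QuantumFields.BalabanUV.Beta.FP.OneShotEffectiveForm (effForm_eq_smul_DelK tsum_wΦ_pshift_eq_effForm minOp_eq_Hk)
open Matrix

/-! ## §1 Torus → `ℤ^{d+1}`: the corner is the periodisation of the infinite-volume (1.66) kernel (RISK R-γ-9 for the leg `𝔊`, quantified) -/

section Deperiodise

open Literature.MathematicalPhysics.QuantumFieldTheory.Balaban1983to89.B4TorusKernel.MultiPeriod (translate translate_apply)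
open Literature.MathematicalPhysics.QuantumFieldTheory.Balaban1983to89.B4Sect5Proof (latticeConst)
open Summit.QuantumFields.BalabanUV.Beta.GAN24.DirichletExhaustionDeltaZ (deltaZ c166Z kappaZ kappaZ_pos deltaZ_abs_le)
open Summit.QuantumFields.BalabanUV.Beta.GAN24.DirichletExhaustionDeperiodise (abs_tsum_translate_sub_le)
open Summit.QuantumFields.BalabanUV.Beta.GAN24.MultiplierDictionary (wΦ_eq_deltaZ)

variable {d : ℕ} (L : ℕ) [NeZero L] (k : ℕ) (M : Fin (d + 1) → ℕ) [∀ ν, NeZero (M ν)]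

omit [∀ ν, NeZero (M ν)] in
/-- [folklore] gan24-p2's multi-period translate IS the shift by a period vector: `translate M z m = z + pshift M m`. -/
theorem translate_eq_add_pshift (z m : Site (d + 1)) : translate M z m = z + pshift M m := by
  funext i
  simp [pshift]

/-- **THE TORUS CORNER IS THE PERIODISATION OF THE INFINITE-VOLUME (1.66) KERNEL** («not in print; our proof» — `OneShotEffectiveForm.tsum_wΦ_pshift_eq_effForm` + gan24-p2's
`MultiplierDictionary.wΦ_eq_deltaZ` BY NAME): for `n = L^k`, every torus `M`, every `z ∈ ℤ^{d+1}`,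
`Re 𝔊_M((z mod M, κ), (0, l)) = n^{d+1} · Σ_m deltaZ L k (z + M∘m, κ) (0, l)`, `𝔊_M = effForm (Kop n M) (QvOp n M)`. -/
theorem effForm_re_eq_tsum_deltaZ (κ l : Fin (d + 1)) (z : Site (d + 1)) :
    (effForm (Kop (L ^ k) M) (QvOp (L ^ k) M) (toTor M z, κ) (0, l)).re
      = ((L : ℝ) ^ k) ^ (d + 1) * ∑' m : Site (d + 1), deltaZ L k (translate M z m, κ) (0, l) := by
  have hL0 : (L : ℝ) ≠ 0 := Nat.cast_ne_zero.mpr (NeZero.ne L)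
  have hc5 : (2 * (((L : ℝ) ^ k) ^ (d + 5))⁻¹) ≠ 0 :=
    mul_ne_zero two_ne_zero (inv_ne_zero (pow_ne_zero _ (pow_ne_zero _ hL0)))
  have hc1 : (((L : ℝ) ^ k) ^ (d + 1)) ≠ 0 := pow_ne_zero _ (pow_ne_zero _ hL0)
  have h6 := tsum_wΦ_pshift_eq_effForm (L ^ k) (one_le_pow_Lc L k) M 1 one_pos κ l z
  have hw : ∀ t : Site (d + 1), wΦ (N := L ^ k) κ l (z + pshift M t)
      = (2 * (((L : ℝ) ^ k) ^ (d + 5))⁻¹) * deltaZ L k (translate M z t, κ) (0, l) := fun t => by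
    rw [wΦ_eq_deltaZ, translate_eq_add_pshift]
  simp_rw [hw] at h6
  rw [tsum_mul_left] at h6
  push_cast at h6
  have hS : ∑' m : Site (d + 1), deltaZ L k (translate M z m, κ) (0, l)
      = (((L : ℝ) ^ k) ^ (d + 1))⁻¹ * (effForm (Kop (L ^ k) M) (QvOp (L ^ k) M) (toTor M z, κ) (0, l)).re :=
    mul_left_cancel₀ hc5 h6
  rw [hS, ← mul_assoc, mul_inv_cancel₀ hc1, one_mul]

/-- **TORUS → `ℤ^{d+1}`, QUANTIFIED** (gan24-p2's `DirichletExhaustionDeperiodise.abs_tsum_translate_sub_le` + `deltaZ_abs_le` BY NAME): on every torus whose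
sides are all `≥ N ≥ 1`, `|Re 𝔊_M((z mod M, κ),(0,l)) − n^{d+1}·deltaZ L k (z,κ) (0,l)| ≤ n^{d+1}·c166Z·K_{d+1}(κ_Z)·e^{κ_Z·dist(0,z)}·e^{−κ_Z(N−1)}` — the finite-torus
corner converges to the infinite-volume (1.66) kernel EXPONENTIALLY in the torus size, uniformly in `z` on any fixed box (constants `c166Z d`, `kappaZ d`,
`latticeConst (d+1) (kappaZ d)` of the tree; `n = L^k`). -/
theorem abs_effForm_re_sub_deltaZ_le {N : ℕ} (hN : 1 ≤ N) (hMN : ∀ i, N ≤ M i) (κ l : Fin (d + 1)) (z : Site (d + 1)) :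
    |(effForm (Kop (L ^ k) M) (QvOp (L ^ k) M) (toTor M z, κ) (0, l)).re - ((L : ℝ) ^ k) ^ (d + 1) * deltaZ L k (z, κ) (0, l)|
      ≤ ((L : ℝ) ^ k) ^ (d + 1) * (c166Z d * latticeConst (d + 1) (kappaZ d) * Real.exp (kappaZ d * dist (0 : Site (d + 1)) z)
          * Real.exp (-(kappaZ d * ((N : ℝ) - 1)))) := by
  have hf : ∀ y : Site (d + 1), |deltaZ L k (y, κ) (0, l)| ≤ c166Z d * Real.exp (-(kappaZ d * dist (0 : Site (d + 1)) y)) := fun y => by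
    rw [dist_comm]; exact deltaZ_abs_le L k (y, κ) (0, l)
  have hC : 0 ≤ c166Z d := by
    have h := (abs_nonneg _).trans (hf 0)
    rwa [dist_self, mul_zero, neg_zero, Real.exp_zero, mul_one] at h
  rw [effForm_re_eq_tsum_deltaZ, ← mul_sub, abs_mul, abs_of_nonneg (by positivity : (0 : ℝ) ≤ ((L : ℝ) ^ k) ^ (d + 1))]
  refine mul_le_mul_of_nonneg_left ?_ (by positivity)
  have h := abs_tsum_translate_sub_le (f := fun y : Site (d + 1) => deltaZ L k (y, κ) (0, l)) (kappaZ_pos d) hC hf hN hMN z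
  simpa only using h

end Deperiodise

/-! ## §2 X1 at finite volume, with rate: the normalised torus corner tends to the periodised perfect Laplacian `Δ_∞` geometrically in the level -/

section PerfectRate

open Literature.MathematicalPhysics.QuantumFieldTheory.Balaban1983to89.B4TorusKernel.MultiPeriod (translate)
open Literature.MathematicalPhysics.QuantumFieldTheory.Balaban1983to89.B4Sect5Proof (latticeConst)
open Summit.QuantumFields.BalabanUV.Beta.GAN24.DirichletExhaustionDeltaZ (deltaZ c166Z theta166Z kappaZ kappaZ_pos deltaZ_abs_le)
open Summit.QuantumFields.BalabanUV.Beta.GAN24.DirichletExhaustionDeperiodise (abs_translate_le summable_translate)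
open Summit.QuantumFields.BalabanUV.Beta.GAN24.DirichletExhaustionTails (summable_expDist)
open Summit.QuantumFields.BalabanUV.Beta.GAN24.EffectiveLaplacianLimit (deltaZLim deltaZLim_abs_le deltaZ_sub_deltaZLim_abs_le)

variable {d : ℕ} (L : ℕ) [NeZero L] (k : ℕ) (M : Fin (d + 1) → ℕ) [∀ ν, NeZero (M ν)]

/-- **X1 AT FINITE VOLUME, WITH RATE** («not in print; our proof» — §1 + this lineage's R42 `GAN24.EffectiveLaplacianLimit.deltaZ_sub_deltaZLim_abs_le` + gan24-p2's
periodisation calculus BY NAME): on EVERY torus `M` (all sides `≥ 1`), for `n = L^k`,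
`|n^{−(d+1)}·Re 𝔊_{M,k}((z mod M, κ),(0,l)) − Σ_m Δ_∞((z + M∘m, κ),(0,l))| ≤ θ_Z·(L⁻²)^k·K_{d+1}(κ_Z)·e^{κ_Z·dist(0,z)}` — the level-`k` corner, normalised by its
weight, converges to the PERIODISED PERFECT EFFECTIVE LAPLACIAN (`deltaZLim = Δ_∞`, L- and k-free) at the geometric rate `(L⁻²)^k`, uniformly in the torus. -/
theorem abs_effForm_re_sub_tsum_deltaZLim_le (κ l : Fin (d + 1)) (z : Site (d + 1)) :
    |(((L : ℝ) ^ k) ^ (d + 1))⁻¹ * (effForm (Kop (L ^ k) M) (QvOp (L ^ k) M) (toTor M z, κ) (0, l)).re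
        - (∑' m : Site (d + 1), deltaZLim (translate M z m, κ) (0, l))|
      ≤ theta166Z d * (((L : ℝ) ^ 2)⁻¹) ^ k * latticeConst (d + 1) (kappaZ d)
          * Real.exp (kappaZ d * dist (0 : Site (d + 1)) z) := by
  have hL0 : (L : ℝ) ≠ 0 := Nat.cast_ne_zero.mpr (NeZero.ne L)
  have hc1 : (((L : ℝ) ^ k) ^ (d + 1)) ≠ 0 := pow_ne_zero _ (pow_ne_zero _ hL0)
  have hM1 : ∀ i, 1 ≤ M i := one_le_M M
  -- the three kernels and their decay letters, centred at `x₀ = 0`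
  set f : Site (d + 1) → ℝ := fun y => deltaZ L k (y, κ) (0, l) with hf_def
  set g : Site (d + 1) → ℝ := fun y => deltaZLim (y, κ) (0, l) with hg_def
  have hf : ∀ y : Site (d + 1), |f y| ≤ c166Z d * Real.exp (-(kappaZ d * dist (0 : Site (d + 1)) y)) := fun y => by
    rw [hf_def, dist_comm]; exact deltaZ_abs_le L k (y, κ) (0, l)
  have hg : ∀ y : Site (d + 1), |g y| ≤ c166Z d * Real.exp (-(kappaZ d * dist (0 : Site (d + 1)) y)) := fun y => by
    rw [hg_def, dist_comm]; exact deltaZLim_abs_le (d := d) (y, κ) (0, l)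
  have hfg : ∀ y : Site (d + 1), |f y - g y| ≤
      theta166Z d * (((L : ℝ) ^ 2)⁻¹) ^ k * Real.exp (-(kappaZ d * dist (0 : Site (d + 1)) y)) := fun y => by
    rw [hf_def, hg_def, dist_comm]; exact deltaZ_sub_deltaZLim_abs_le L k (y, κ) (0, l)
  have hC : 0 ≤ c166Z d := by
    have h := (abs_nonneg _).trans (hf 0)
    rwa [dist_self, mul_zero, neg_zero, Real.exp_zero, mul_one] at h
  have hCk : 0 ≤ theta166Z d * (((L : ℝ) ^ 2)⁻¹) ^ k := by
    have h := (abs_nonneg _).trans (hfg 0)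
    rwa [dist_self, mul_zero, neg_zero, Real.exp_zero, mul_one] at h
  -- §1: the normalised corner IS the periodisation of `f`
  rw [effForm_re_eq_tsum_deltaZ, ← mul_assoc, inv_mul_cancel₀ hc1, one_mul]
  have hfs : Summable fun m : Site (d + 1) => f (translate M z m) := summable_translate (kappaZ_pos d) hC hf hM1 z
  have hgs : Summable fun m : Site (d + 1) => g (translate M z m) := summable_translate (kappaZ_pos d) hC hg hM1 z
  change |∑' m : Site (d + 1), f (translate M z m) - ∑' m : Site (d + 1), g (translate M z m)| ≤ _
  rw [← hfs.tsum_sub hgs]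
  -- termwise bound and the lattice sum
  obtain ⟨hes, hele⟩ := summable_expDist (d := d) (kappaZ_pos d)
  have hterm : ∀ m : Site (d + 1), |f (translate M z m) - g (translate M z m)| ≤
      theta166Z d * (((L : ℝ) ^ 2)⁻¹) ^ k * Real.exp (kappaZ d * dist (0 : Site (d + 1)) z)
        * Real.exp (-(kappaZ d * dist (0 : Site (d + 1)) m)) := fun m =>
    abs_translate_le (f := fun y => f y - g y) (kappaZ_pos d).le hCk hfg hM1 z m
  have hrs : Summable fun m : Site (d + 1) => theta166Z d * (((L : ℝ) ^ 2)⁻¹) ^ k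
      * Real.exp (kappaZ d * dist (0 : Site (d + 1)) z) * Real.exp (-(kappaZ d * dist (0 : Site (d + 1)) m)) :=
    hes.mul_left _
  have hns : Summable fun m : Site (d + 1) => ‖f (translate M z m) - g (translate M z m)‖ :=
    hrs.of_norm_bounded fun m => by rw [norm_norm, Real.norm_eq_abs]; exact hterm m
  calc |∑' m : Site (d + 1), (f (translate M z m) - g (translate M z m))|
      ≤ ∑' m : Site (d + 1), |f (translate M z m) - g (translate M z m)| := by
        have h := norm_tsum_le_tsum_norm hns
        simpa only [Real.norm_eq_abs] using h
    _ ≤ ∑' m : Site (d + 1), theta166Z d * (((L : ℝ) ^ 2)⁻¹) ^ k * Real.exp (kappaZ d * dist (0 : Site (d + 1)) z)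
          * Real.exp (-(kappaZ d * dist (0 : Site (d + 1)) m)) :=
        Summable.tsum_le_tsum hterm (by simpa only [Real.norm_eq_abs] using hns) hrs
    _ = theta166Z d * (((L : ℝ) ^ 2)⁻¹) ^ k * Real.exp (kappaZ d * dist (0 : Site (d + 1)) z)
          * ∑' m : Site (d + 1), Real.exp (-(kappaZ d * dist (0 : Site (d + 1)) m)) := tsum_mul_left
    _ ≤ theta166Z d * (((L : ℝ) ^ 2)⁻¹) ^ k * Real.exp (kappaZ d * dist (0 : Site (d + 1)) z)
          * latticeConst (d + 1) (kappaZ d) := mul_le_mul_of_nonneg_left hele (by positivity)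
    _ = _ := by ring

end PerfectRate

/-! ## §3 The minimiser leg's letters on every torus: `minOp = H_k^{(1.63)}`, exponentially localised uniformly in the level -/

section MinimiserLetters

open Literature.MathematicalPhysics.QuantumFieldTheory.Balaban1983to89.B4TorusKernel (periodConst)
open Literature.MathematicalPhysics.QuantumFieldTheory.Balaban1983to89.B4TorusKernel.MultiPeriod (torusSupNorm)
open Literature.MathematicalPhysics.QuantumFieldTheory.Balaban1983to89.B5Block118 (bpt)
open Literature.MathematicalPhysics.QuantumFieldTheory.Balaban1983to89.B5Hk163Strip (kappa163)
open Literature.MathematicalPhysics.QuantumFieldTheory.Balaban1983to89.B5Hk163Decay (MG163)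
open Literature.MathematicalPhysics.QuantumFieldTheory.Balaban1983to89.B5Hk163Torus (HkOp norm_HkOp_le)
open Literature.MathematicalPhysics.QuantumFieldTheory.Balaban1983to89.B5Hk163Form166 (HkOp_eq_Hk)
open Literature.MathematicalPhysics.QuantumFieldTheory.Balaban1983to89.B6LowerBound2153Torus (toT)

variable {d : ℕ} (n : ℕ) [NeZero n] (hn : 1 ≤ n)

include hn in
/-- **THE MINIMISER BLOCK IS THE MOMENTUM-SPACE (1.63) OPERATOR**: `minOp (Kop n M) (QvOp n M) = HkOp n M` (`OneShotEffectiveForm.minOp_eq_Hk` + b05∕pv15's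
`B5Hk163Form166.HkOp_eq_Hk` BY NAME) — every `d`, every torus. [folklore] -/
theorem minOp_eq_HkOp (M : Fin d → ℕ) [∀ μ, NeZero (M μ)] : minOp (Kop n M) (QvOp n M) = HkOp n M := by
  rw [minOp_eq_Hk n hn M 1 one_pos, HkOp_eq_Hk n hn M 1 one_pos]

include hn in
/-- **THE LEG `𝓘`'s LETTERS, UNIFORM IN THE LEVEL AND THE TORUS** (dimension `d + 1`; pv15's `B5Hk163Torus.norm_HkOp_le` BY NAME): for lattice
representatives `x′, x ∈ ℤ^{d+1}`, every fine offset `a` and all legs,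
`‖𝓘((n·x̄′ + a, μ), (x̄, λ))‖ ≤ MG163(d+1)·periodConst(κ₁₆₃(d+1), d)·e^{−(κ₁₆₃(d+1)∕(d+1))·|x′ − x|_{T,∞}}`, `𝓘 = minOp (Kop n M) (QvOp n M)` —
constants dimension-only (the tree's, crude), uniformly in `n ≥ 1` and in `M` — the SHAPE of RHOA-6c′'s leg letters (I)∕(J) for `𝓘` at `U = 𝟙` in block-index
currency (module docstring). [folklore] -/
theorem norm_minOp_bpt_le (M : Fin (d + 1) → ℕ) [∀ μ, NeZero (M μ)] (μ lam : Fin (d + 1)) (a : Fin (d + 1) → Fin n)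
    (x' x : Fin (d + 1) → ℤ) :
    ‖minOp (Kop n M) (QvOp n M) (bpt n M (toT M x') a, μ) (toT M x, lam)‖
      ≤ MG163 (d + 1) * periodConst (kappa163 (d + 1)) d *
          Real.exp (-(kappa163 (d + 1) / (d + 1) * torusSupNorm M (x' - x))) := by
  rw [minOp_eq_HkOp n hn M]
  exact norm_HkOp_le n M μ lam a x' x

end MinimiserLetters

end Summit.QuantumFields.BalabanUV.Beta.FP.OneShotEffectiveFormLetters

end
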